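import Mathlib
import HarnessLib
import Summits.HubbardSuperconductivity.HubbardSuperconductivity.Theorems.WeakCouplingBCSKlCertTPrimePocketRadius

/-!
# Route `WeakCouplingBCS` — certificate vocabulary for `WcbcsKohnLuttingerB1g` (stmt-HubbardSuperconductivity-0158):
# the `t′` band radius is CONTINUOUS (jointly in level and angle) — brick (N1)-2 of «TPRIME-LINDHARD-HS»

Cell `gate-hubbard-kl`, seat margin-1 (g18), zero kit; executed for the p4 lineage's programme «TPRIME-LINDHARD-HS» (pen g27 (R467)(C) GO).  Continues
`Theorems/WeakCouplingBCSKlCertTPrimePocketRadius.lean` ((N1)-1: `kltpRay`, `kltpRadius`, `kltpPolar`, `kltpPocketPolar`) with the `t′`-twin of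
`Literature/MathematicalPhysics/QuantumLattice/HubbardFermiRadiusBandContinuous.lean` §1: the root of a jointly continuous, radially strictly increasing
function depends continuously on `(μ, θ)` (the squeeze argument verbatim, `kltpRay` for `rayDispersion`).  The chart is the Γ-CENTRED one (`kltpPolar`); for the
hole pocket about `M` of `ε_{t′}` at `μ` (`t′ < 0`, `4t′ < μ < 4 − 4t′`) the continuous/C¹ chart for the `L²` route is `kltpPolar (−t′) (−μ)` of the reflected
band (the zone representative `kltpPocketPolar = klphShift ∘ kltpPolar (−t′) (−μ)` jumps at the coordinate axes and is used only pointwise).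

* `continuous_kltpRay_uncurry` (joint continuity of `(θ, t) ↦ F_{t′}(θ, t)`); the angular derivative `kltpRayDθ` with `hasDerivAt_kltpRay_angle` (input of the
  implicit-function brick (N1)-3, twin of `rayDispersionDθ`);
* **`continuousOn_kltpRadius`**: `(μ, θ) ↦ u_{t′,μ}(θ)` is continuous on `(−4 − 4t′, 4t′) × ℝ` for `|t′| < 1/2`; `continuous_kltpRadius` (fixed level);
  **`continuous_kltpPolar`** (the Γ-centred `t′` Fermi curve is a continuous closed curve); `kltpRadius_add_two_pi` (`2π`-periodicity).

One definition (`kltpRayDθ`), no `instance`, no `notation`.  Nothing here asserts a record, a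
margin, `K₃`, `U₀`, the window or superconductivity; a Kohn–Luttinger `O(U²)` channel statement is not ODLRO; nothing here proves superconductivity in the
Hubbard model.
References: G. Benfatto, A. Giuliani, V. Mastropietro, Ann. Henri Poincaré 7 (2006) 809–898, §1 (1.4)–(1.5); S. Raghu, S. A. Kivelson, D. J. Scalapino,
Phys. Rev. B 81 (2010) 224505, §III.
-/

noncomputable section

-- the tree's namespace `Summit.<Summit>.<Problem>.Theorems` repeats the summit name by design (D-0017)
set_option linter.dupNamespace false

namespace Summit.HubbardSuperconductivity.HubbardSuperconductivity.Theorems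

open Real Set Filter Literature.MathematicalPhysics.QuantumLattice
open scoped Topology

/-- The ray function is jointly continuous in `(θ, t)` (indeed real-analytic). [folklore] -/
theorem continuous_kltpRay_uncurry (tp : ℝ) : Continuous fun p : ℝ × ℝ => kltpRay tp p.1 p.2 := by
  unfold kltpRay; fun_prop


/-- The angular derivative `∂_θ F_{t′}(θ, t) = 2t(cos θ sin(t sin θ) − sin θ sin(t cos θ)) − 4t′t(sin θ sin(t cos θ) cos(t sin θ) − cos θ cos(t cos θ) sin(t sin θ))`.
[folklore] -/
def kltpRayDθ (tp θ t : ℝ) : ℝ :=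
  2 * t * (Real.cos θ * Real.sin (t * Real.sin θ) - Real.sin θ * Real.sin (t * Real.cos θ)) -
    4 * tp * t * (Real.sin θ * Real.sin (t * Real.cos θ) * Real.cos (t * Real.sin θ) - Real.cos θ * Real.cos (t * Real.cos θ) * Real.sin (t * Real.sin θ))

/-- `∂_θ F_{t′}`: the derivative of `θ ↦ F_{t′}(θ, t)`. [folklore] -/
theorem hasDerivAt_kltpRay_angle (tp θ t : ℝ) : HasDerivAt (fun ϑ => kltpRay tp ϑ t) (kltpRayDθ tp θ t) θ := by
  have h0 : HasDerivAt (fun ϑ => Real.cos (t * Real.cos ϑ)) (-Real.sin (t * Real.cos θ) * (t * -Real.sin θ)) θ :=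
    ((Real.hasDerivAt_cos θ).const_mul t).cos
  have h1 : HasDerivAt (fun ϑ => Real.cos (t * Real.sin ϑ)) (-Real.sin (t * Real.sin θ) * (t * Real.cos θ)) θ :=
    ((Real.hasDerivAt_sin θ).const_mul t).cos
  have h := ((h0.add h1).const_mul (-2 : ℝ)).sub (((h0.mul h1).const_mul (4 * tp)))
  have hfun : (fun ϑ => kltpRay tp ϑ t) = (fun y => -2 * ((fun ϑ => Real.cos (t * Real.cos ϑ)) + fun ϑ => Real.cos (t * Real.sin ϑ)) y) -
      fun y => 4 * tp * (((fun ϑ => Real.cos (t * Real.cos ϑ)) * fun ϑ => Real.cos (t * Real.sin ϑ)) y) := by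
    funext ϑ
    simp only [kltpRay, Pi.add_apply, Pi.mul_apply, Pi.sub_apply]
    ring
  rw [hfun]
  refine h.congr_deriv ?_
  rw [kltpRayDθ]; ring

/-- **`(μ, θ) ↦ u_{t′,μ}(θ)` is continuous on the Γ-pocket window `(−4 − 4t′, 4t′) × ℝ`**, `|t′| < 1/2` (the root of a jointly continuous, radially strictly
increasing function — the squeeze argument of `continuousOn_bandFermiRadius` verbatim with `kltpRay` for `rayDispersion`). [folklore] -/
theorem continuousOn_kltpRadius {tp : ℝ} (htp : |tp| < 1 / 2) :
    ContinuousOn (fun p : ℝ × ℝ => kltpRadius tp p.1 p.2) (Ioo (-4 - 4 * tp) (4 * tp) ×ˢ univ) := by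
  rw [Metric.continuousOn_iff]
  rintro ⟨μ, θ⟩ ⟨⟨hμ₁, hμ₂⟩, -⟩ ε hε
  set t₀ := kltpRadius tp μ θ with ht₀
  have ht₀pos : 0 < t₀ := kltpRadius_pos htp hμ₁ hμ₂ θ
  have ht₀lt : t₀ < π / ‖dir θ‖ := kltpRadius_lt_exit htp hμ₁ hμ₂ θ
  set ε' := min ε (min t₀ (π / ‖dir θ‖ - t₀)) / 2 with hε'
  have hmpos : 0 < min ε (min t₀ (π / ‖dir θ‖ - t₀)) := lt_min hε (lt_min ht₀pos (by linarith))
  have hε'pos : 0 < ε' := by positivity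
  have hε'le : ε' < ε := by
    have : min ε (min t₀ (π / ‖dir θ‖ - t₀)) ≤ ε := min_le_left _ _
    linarith
  have hlo : 0 < t₀ - ε' := by
    have : min ε (min t₀ (π / ‖dir θ‖ - t₀)) ≤ t₀ := (min_le_right _ _).trans (min_le_left _ _)
    linarith
  have hhi : t₀ + ε' < π / ‖dir θ‖ := by
    have : min ε (min t₀ (π / ‖dir θ‖ - t₀)) ≤ π / ‖dir θ‖ - t₀ :=
      (min_le_right _ _).trans (min_le_right _ _)
    linarith
  have hmono := strictMonoOn_kltpRay htp θ
  have hmemlo : t₀ - ε' ∈ Icc 0 (π / ‖dir θ‖) := ⟨hlo.le, by linarith⟩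
  have hmemhi : t₀ + ε' ∈ Icc 0 (π / ‖dir θ‖) := ⟨by linarith, hhi.le⟩
  have hmem0 : t₀ ∈ Icc 0 (π / ‖dir θ‖) := ⟨ht₀pos.le, ht₀lt.le⟩
  have hbelow : kltpRay tp θ (t₀ - ε') < μ := by
    have h := hmono hmemlo hmem0 (by linarith)
    rwa [kltpRay_kltpRadius htp hμ₁ hμ₂ θ] at h
  have habove : μ < kltpRay tp θ (t₀ + ε') := by
    have h := hmono hmem0 hmemhi (by linarith)
    rwa [kltpRay_kltpRadius htp hμ₁ hμ₂ θ] at h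
  -- the three strict inequalities persist for nearby `(μ', θ')`
  have hc : ∀ t : ℝ, Continuous fun p : ℝ × ℝ => kltpRay tp p.2 t - p.1 := fun t =>
    ((continuous_kltpRay_uncurry tp).comp (continuous_snd.prodMk continuous_const)).sub continuous_fst
  have hT : Continuous fun p : ℝ × ℝ => π / ‖dir p.2‖ :=
    continuous_const.div (continuous_norm_dir.comp continuous_snd) fun p => (norm_dir_pos p.2).ne'
  have hbelow' : (fun p : ℝ × ℝ => kltpRay tp p.2 (t₀ - ε') - p.1) (μ, θ) < 0 := by
    simp only; linarith
  have habove' : 0 < (fun p : ℝ × ℝ => kltpRay tp p.2 (t₀ + ε') - p.1) (μ, θ) := by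
    simp only; linarith
  have hhi' : t₀ + ε' < (fun p : ℝ × ℝ => π / ‖dir p.2‖) (μ, θ) := by simpa using hhi
  have hev1 : ∀ᶠ p : ℝ × ℝ in 𝓝 (μ, θ), kltpRay tp p.2 (t₀ - ε') - p.1 < 0 :=
    (hc (t₀ - ε')).continuousAt.eventually (gt_mem_nhds hbelow')
  have hev2 : ∀ᶠ p : ℝ × ℝ in 𝓝 (μ, θ), 0 < kltpRay tp p.2 (t₀ + ε') - p.1 :=
    (hc (t₀ + ε')).continuousAt.eventually (lt_mem_nhds habove')
  have hev3 : ∀ᶠ p : ℝ × ℝ in 𝓝 (μ, θ), t₀ + ε' < π / ‖dir p.2‖ :=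
    hT.continuousAt.eventually (lt_mem_nhds hhi')
  have hev4 : ∀ᶠ p : ℝ × ℝ in 𝓝 (μ, θ), p.1 ∈ Ioo (-4 - 4 * tp) (4 * tp) :=
    continuous_fst.continuousAt.eventually (isOpen_Ioo.mem_nhds ⟨hμ₁, hμ₂⟩)
  have hev : ∀ᶠ p : ℝ × ℝ in 𝓝 (μ, θ), (kltpRay tp p.2 (t₀ - ε') - p.1 < 0 ∧
      0 < kltpRay tp p.2 (t₀ + ε') - p.1) ∧ (t₀ + ε' < π / ‖dir p.2‖ ∧ p.1 ∈ Ioo (-4 - 4 * tp) (4 * tp)) :=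
    (hev1.and hev2).and (hev3.and hev4)
  obtain ⟨δ, hδ, hball⟩ := Metric.eventually_nhds_iff.1 hev
  refine ⟨δ, hδ, fun p _ hp => ?_⟩
  obtain ⟨⟨h1, h2⟩, h3, hμ'⟩ := hball hp
  have hu' := isKltpRadius_kltpRadius htp hμ'.1 hμ'.2 p.2
  have hmono' := strictMonoOn_kltpRay htp p.2
  have hmemlo' : t₀ - ε' ∈ Icc 0 (π / ‖dir p.2‖) := ⟨hlo.le, by linarith⟩
  have hmemhi' : t₀ + ε' ∈ Icc 0 (π / ‖dir p.2‖) := ⟨by linarith, h3.le⟩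
  have hgt : t₀ - ε' < kltpRadius tp p.1 p.2 := by
    by_contra h
    have h : kltpRadius tp p.1 p.2 ≤ t₀ - ε' := le_of_not_gt h
    have := hmono'.monotoneOn hu'.mem_Icc hmemlo' h
    rw [hu'.2] at this
    linarith
  have hlt' : kltpRadius tp p.1 p.2 < t₀ + ε' := by
    by_contra h
    have h : t₀ + ε' ≤ kltpRadius tp p.1 p.2 := le_of_not_gt h
    have := hmono'.monotoneOn hmemhi' hu'.mem_Icc h
    rw [hu'.2] at this
    linarith
  rw [Real.dist_eq, abs_lt]
  constructor <;> linarith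

/-- **Continuity in the angle at fixed level**: `θ ↦ u_{t′,μ}(θ)` is continuous, `|t′| < 1/2`, `−4 − 4t′ < μ < 4t′`. [folklore] -/
theorem continuous_kltpRadius {tp μ : ℝ} (htp : |tp| < 1 / 2) (hμ₁ : -4 - 4 * tp < μ) (hμ₂ : μ < 4 * tp) :
    Continuous (kltpRadius tp μ) := by
  have h := (continuousOn_kltpRadius htp).comp_continuous (continuous_const.prodMk continuous_id)
    fun θ => ⟨⟨hμ₁, hμ₂⟩, mem_univ θ⟩
  exact h

/-- **The polar parametrisation of the Γ-centred `t′` Fermi curve is a continuous closed curve.** [folklore] -/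
theorem continuous_kltpPolar {tp μ : ℝ} (htp : |tp| < 1 / 2) (hμ₁ : -4 - 4 * tp < μ) (hμ₂ : μ < 4 * tp) :
    Continuous (kltpPolar tp μ) := by
  have hd : Continuous dir := by
    refine continuous_pi fun i => ?_
    fin_cases i <;> simp [dir] <;> fun_prop
  exact (PiLp.continuous_toLp 2 _).comp ((continuous_kltpRadius htp hμ₁ hμ₂).smul hd)

/-- `u_{t′,μ}` is `2π`-periodic (the ray function is). [folklore] -/
theorem kltpRadius_add_two_pi {tp μ : ℝ} (htp : |tp| < 1 / 2) (hμ₁ : -4 - 4 * tp < μ) (hμ₂ : μ < 4 * tp) (θ : ℝ) :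
    kltpRadius tp μ (θ + 2 * π) = kltpRadius tp μ θ := by
  have hu := isKltpRadius_kltpRadius htp hμ₁ hμ₂ θ
  symm
  refine kltpRadius_unique htp hμ₁ hμ₂ ⟨?_, ?_⟩
  · have hn : ‖dir (θ + 2 * π)‖ = ‖dir θ‖ := by rw [norm_dir, norm_dir, Real.cos_add_two_pi, Real.sin_add_two_pi]
    rw [hn]; exact hu.1
  · have : kltpRay tp (θ + 2 * π) = kltpRay tp θ := by
      funext t; simp [kltpRay, Real.cos_add_two_pi, Real.sin_add_two_pi]
    rw [this]; exact hu.2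

end Summit.HubbardSuperconductivity.HubbardSuperconductivity.Theorems

end
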